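import Literature.MathematicalPhysics.QuantumFieldTheory.Balaban1983to89.B6QGQDecay237
import Literature.MathematicalPhysics.QuantumFieldTheory.Balaban1983to89.Beta.EntrywiseVolumeLimit

/-!
# The k-UNIFORM FLAT ONE-STEP LETTERS of row (D4) in its own currency — `G₀ = (−Δ^η + aQ*Q)⁻¹`, `QG₀Q*` and `(QG₀Q*)⁻¹`
# on `ℤ^d` as `Kernel₂`'s with `Decay₂` ∕ `compKer` ∕ `IsPeriodic₂`, all constants functions of `d, a` only — READ BY NAME
# from the tree's `B6QGQDecay237` ∕ `B6QGQLower276` ∕ `B4Sect5Exhaustion` (`Beta.RemainderKernelFlatBridge`)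

statement-level skeleton of published theorems with citation tags; proofs where landed; nothing here is a claim
about the Yang–Mills mass gap.

HONEST FRAMING (cell rule).  Bookkeeping for the k-uniform remainder chain of row (D4) (`RemainderConst` ⇐ ONE
`ChainTFac190` instance, `Beta.RemainderDecay190`); discharges NOTHING of `BetaPertH`; NOT B12 Thm 2, NOT the continuum
limit, NOT Clay.  Unit `b2b-balaban-beta-an4` gen 100 (BINDER row D4 OWNER; cell pub-balaban).  A BRIDGE, [folklore]
bookkeeping only: every estimate is IMPORTED BY NAME from `B6QGQDecay237` (mesh-free Combes–Thomas decay of `G′` on the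
whole lattice and of `Q′G′Q′*`, the mesh-free (5.6) for `Q′G′Q′*`, the mesh-free decay of `(Q′G′Q′*)_Λ⁻¹`), `B6QGQLower276`
(the site matrix `AX n a` of `Δ^η + aQ*Q`, blocks `B n y`, the kernel `kerQGQ`, the lower bound `gammaQ` = [3] (2.76)) and
`B4Sect5Exhaustion` (the exhaustion-limit inverse `limInv`, its two-sided inverse identities `tsum_mul_limInv` ∕
`tsum_limInv_mul`, symmetry, decay); the row's letters come from gen 9's `Beta.EntrywiseVolumeLimit` (`Kernel₂`, `compKer`,
`kdelta`, `Decay₂`, `RowBound`, `IsPeriodic₂`, `IsPeriodic₂.of_inverse`, `Decay₂.rowBound`).  Nothing is re-proved.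

WHY.  The row-(D4) model road consumes, per window, `ℤ^d` kernels `S` with `compKer T S = kdelta`, `Decay₂ S C δ`,
`IsPeriodic₂ s S` whose torus periodisations are the torus operators (NODE D–E: `RemainderDecay190Periodised.
exists_data190_of_periodised_cubes_supNorm`'s `hS` ∕ `hdec` ∕ `hent`; `RemainderKernelPeriodised`; gen 9's Lemma 2.2.2), with
constants that must NOT depend on the RG step `k`, i.e. on the block side `L^k = n + 1`.  Gens 96–99 of this lineage built
such kernels by a first-order Combes–Thomas argument whose rate degraded with the block side and recorded «[5] Prop. 1.2's
δ₀ NOT reached».  The tree ALREADY HELD the mesh-free statements since 2026-08-19, in the `X d` ∕ `limInv` ∕ sup-distance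
currency of the B4–B6 readers: this file transcribes them into the row's letters, so that the flat one-step inputs of
NODE O.2 are available k-uniformly BY NAME:

* §1  dictionary: sums over `K d 1 = ℤ^d × Fin 1` are sums over `ℤ^d` (`tsum_K1`); the `ℓ¹` size is at most `d` times
  the sup distance, so sup-distance decay at rate `δ` is `Decay₂` at rate `δ∕d` (`decay₂_of_dist_decay`);
  `RowBound` from a sup-distance entry bound (`rowBound_of_dist_decay`).
* §2  **`G′ = (Δ^η + aQ*Q)⁻¹` on the whole lattice** (site units, mesh `η = 1∕(n+1)`, site matrix `AX n a = (n+1)²(−Δ_sites) +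
  a(n+1)^{−d}1[same block]`; `G′(x,y) = limInv ℤ^d (Aker n a) (x,0) (y,0)`): `flatGreen_two_sided` (`AX ∘ G′ = δ = G′ ∘ AX`),
  `flatGreen_decay` (`Decay₂ G′ (2∕min(2,a)) (δ_u(d,a)∕(d(n+1)))` — rate `δ_u∕d` PER BLOCK, free of `n`), `AX_isPeriodic₂`,
  `flatGreen_isPeriodic₂` (`IsPeriodic₂ (n+1) G′`, by `IsPeriodic₂.of_inverse`).
* §3  **`QG′Q*` on the unit lattice** (`kerQGQ n a y y′ = (n+1)^{−d}Σ_{p∈B(y),q∈B(y′)}G′(p,q)`): `qgq_decay` (`Decay₂ (cU d a)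
  (δ_u∕d)` — PREFACTOR AND RATE free of `n`), `qgq_lower` (the form bound `gammaQ(d,a)·Σf² ≤ ΣΣ f·(QG′Q*)·f` on every finset =
  [3] (2.76) mesh-free), `qgq_transInv` (`IsPeriodic₂ 1`, i.e. translation invariance, from §2 by re-indexing the blocks).
* §4  **`(QG′Q*)⁻¹` on the unit lattice** (`limInv ℤ^d (KerQGQ n a)`): `qgqInv_two_sided`, `qgqInv_decay` (`Decay₂ (cInv d a)
  (deltaInv d a∕d)`), `qgqInv_transInv` — [B9] (3.132)'s flat unit-lattice case with `d,a`-only constants.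
* §5  `flatLetters_uniform` — the three letters packaged in one statement.
WHAT IS *NOT* DONE: nothing analytic is proved here (all by name); scalar `U = 1` flat case only — no covariant ∕
multi-level operator, no `H_k = G′Q*(QG′Q*)⁻¹` letter ([5] (1.103), fine×unit: on `ℤ^d` the scalar `H` is
`B5Hk103ScalarZd.kerH` with mesh-free block-RMS decay; on the TORUS the vector `H_k` of (1.63) is `B5Hk163Torus.HkOp` with
k-uniform pointwise decay `norm_HkOp_le` — neither bridged here: the row's sockets have no fine×unit carrier yet), no
(189)–(190) data of [15]; no identification of these kernels with the pieces `a₀, h₀, h, 𝔡` of `RemainderDecay190Periodised`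
(that is NODE O's statement about Bałaban's Sect.-G operators); row D4 class UNCHANGED (instance 0∕1; critical-path width
0 = NODE O; D4 DISCHARGE NO DATE).  No `def`, no named fact, no `sorry`, standard axioms.
HONEST DEPENDENCY: continuum YM on T⁴ ⇐ BetaPertH ∧ nine spine estimates (0/9 proved); BetaPertH ⇐ (D1) ∧ (D4) ∧
CAP+tail; G-an2-4 gates asym, D1 and NE2/3/4.

Sources: [5] = T. Bałaban, Commun. Math. Phys. **95** (1984) 17–40 [Balaban1984PropagatorsI], (1.99)–(1.103) p. 34, Prop. 1.2
p. 35, remark p. 36; [3] = Commun. Math. Phys. **96** (1984) 223–250 [Balaban1984PropagatorsII], (2.74)–(2.79) pp. 236–237;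
[4] = Commun. Math. Phys. **89** (1983) 571–597 [Balaban1983RegularityDecay], Sect. 5 Theorem (5.6)–(5.8) p. 594; [B9] = Commun.
Math. Phys. **99** (1985) 389–434 [Balaban1985BackgroundPropagators], (3.132) p. 422; G. Slade, Commun. Math. Phys. **358**
(2018) [Slade2017], Lemma 2.2.2 (via `EntrywiseVolumeLimit`).
-/

namespace Literature.MathematicalPhysics.QuantumFieldTheory.Balaban1983to89.Beta.RemainderKernelFlatBridge

open Finset
open Literature.MathematicalPhysics.QuantumFieldTheory.Balaban1983to89
open Literature.MathematicalPhysics.QuantumFieldTheory.Balaban1983to89.B12Sec2to5 (l1 l1_nonneg abs_coord_le_l1)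
open Literature.MathematicalPhysics.QuantumFieldTheory.Balaban1983to89.Beta
  (Kernel₂ Decay₂ IsPeriodic₂ RowBound compKer kdelta imageShift imageShift_apply imageShift_left_injective)
open Literature.MathematicalPhysics.QuantumFieldTheory.Balaban1983to89.B4Sect5Exhaustion
  (K Hyp56Z limInv tendsto_limInv limInv_abs_le limInv_symm tsum_mul_limInv tsum_limInv_mul)
open Literature.MathematicalPhysics.QuantumFieldTheory.Balaban1983to89.B4Sect5Proof (latticeConst latticeSum_le)
open Literature.MathematicalPhysics.QuantumFieldTheory.Balaban1983to89.B6QGQLower276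
  (X side blk chart B mem_B blk_chart AX Aker AX_symm abs_AX_le c0 c0_pos hyp56Z_Aker kerQGQ KerQGQ kerQGQ_symm qGq_lower
  gammaQ gammaQ_pos sameBlk lapKer)
open Literature.MathematicalPhysics.QuantumFieldTheory.Balaban1983to89.B6QGQDecay237
  (deltaU deltaU_pos cU cU_pos cInv cInv_pos deltaInv deltaInv_pos gPrime_entry_decay abs_kerQGQ_le_unif
  hyp56Z_KerQGQ_unif qGqInv_decay_unif)
open _root_.Filter
open scoped _root_.Topology

variable {d : ℕ}

/-! ## §1. Dictionary: `K d 1` sums, sup distance versus `ℓ¹`, decay and row bounds -/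

/-- Sums over the ambient index set `K d 1 = ℤ^d × Fin 1` of the B4 readers are sums over `ℤ^d`.
[cite: Balaban1983RegularityDecay, Sect. 5 Theorem p.594] [folklore] -/
theorem tsum_K1 (f : K d 1 → ℝ) : ∑' q, f q = ∑' x : Fin d → ℤ, f (x, 0) := by
  rw [← (Equiv.prodUnique (Fin d → ℤ) (Fin 1)).symm.tsum_eq]
  rfl

/-- Sup-distance decay at rate `δ ≥ 0` is `Decay₂` at rate `δ∕d`. [cite: Balaban1987RG1, (5.10) p.293] [folklore] -/
theorem decay₂_of_dist_decay {S : Kernel₂ d} {C δ : ℝ} (hδ : 0 ≤ δ)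
    (h : ∀ x y, |S x y| ≤ C * Real.exp (-(δ * dist x y))) : Decay₂ S C (δ / d) := by
  intro x y
  refine (h x y).trans ?_
  have hC : 0 ≤ C := by
    have h0 := (abs_nonneg _).trans (h x x)
    rw [dist_self, mul_zero, neg_zero, Real.exp_zero, mul_one] at h0
    exact h0
  refine mul_le_mul_of_nonneg_left (Real.exp_le_exp.2 ?_) hC
  rw [neg_mul, neg_le_neg_iff]
  rcases Nat.eq_zero_or_pos d with hd | hd
  · subst hd; simp; positivity
  · have hd' : (0 : ℝ) < d := by exact_mod_cast hd
    -- `|x − y|₁ ≤ d · dist(x, y)` (sup distance of `ℤ^d ⊂ ℝ^d`; cf. the Summits-side `GAN24.DirichletExhaustionDecays`)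
    have hl1 : l1 (x - y) ≤ d * dist x y := by
      have hco : ∀ i, |((x - y) i : ℝ)| ≤ dist x y := by
        intro i
        have h := dist_le_pi_dist x y i
        rw [Int.dist_eq] at h
        simpa [Pi.sub_apply] using h
      calc l1 (x - y) = ∑ i : Fin d, |((x - y) i : ℝ)| := rfl
        _ ≤ ∑ _i : Fin d, dist x y := Finset.sum_le_sum fun i _ => hco i
        _ = d * dist x y := by simp
    calc δ / d * l1 (x - y) ≤ δ / d * (d * dist x y) := mul_le_mul_of_nonneg_left hl1 (by positivity)
      _ = δ * dist x y := by field_simp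

/-- A sup-distance entry bound at rate `δ > 0` gives a uniform row bound `C · K_d(δ)` (`B4Sect5Proof.latticeConst`).
[cite: Balaban1983RegularityDecay, Sect. 5 Theorem p.594] [folklore] -/
theorem rowBound_of_dist_decay {S : Kernel₂ d} {C δ : ℝ} (hC : 0 ≤ C) (hδ : 0 < δ)
    (h : ∀ x y, |S x y| ≤ C * Real.exp (-(δ * dist x y))) : RowBound S (C * latticeConst d δ) := by
  intro x
  have hsum : Summable fun y : Fin d → ℤ => C * Real.exp (-(δ * dist x y)) :=
    (summable_of_sum_le (fun _ => (Real.exp_pos _).le) (latticeSum_le d hδ · x)).mul_left C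
  have hS : Summable fun y => |S x y| :=
    Summable.of_nonneg_of_le (fun _ => abs_nonneg _) (fun y => h x y) hsum
  refine ⟨hS, ?_⟩
  calc ∑' y, |S x y| ≤ ∑' y, C * Real.exp (-(δ * dist x y)) := hS.tsum_le_tsum (fun y => h x y) hsum
    _ = C * ∑' y, Real.exp (-(δ * dist x y)) := tsum_mul_left
    _ ≤ C * latticeConst d δ := mul_le_mul_of_nonneg_left
        ((summable_of_sum_le (fun _ => (Real.exp_pos _).le) (latticeSum_le d hδ · x)).tsum_le_of_sum_le
          (latticeSum_le d hδ · x)) hC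

/-! ## §2. The flat Green's function `G′ = (Δ^η + aQ*Q)⁻¹` on the whole lattice as a row letter -/

section Flat

variable (n : ℕ) {a : ℝ}

/-- **`G′` IS A TWO-SIDED INVERSE OF `Δ^η + aQ*Q` ON `ℤ^d`** in the row's letters: `compKer (AX) G′ = δ = compKer G′ (AX)`
(B4Sect5Exhaustion's `tsum_mul_limInv` ∕ `tsum_limInv_mul` at `Ω = ℤ^d`). [cite: Balaban1984PropagatorsII, p.236] [folklore] -/
theorem flatGreen_two_sided (ha : 0 < a) :
    compKer (fun x y : Fin d → ℤ => AX n a x y) (fun x y => limInv Set.univ (Aker n a) (x, 0) (y, 0)) = kdelta ∧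
    compKer (fun x y : Fin d → ℤ => limInv Set.univ (Aker n a) (x, 0) (y, 0)) (fun x y => AX n a x y) = kdelta := by
  have hγ : 0 < min 2 a := lt_min two_pos ha
  have hc : 0 < c0 d n a := c0_pos d n ha.ne'
  have hA := hyp56Z_Aker (d := d) n a
  constructor
  · funext x z
    have h := tsum_mul_limInv hγ hc one_pos hA (p := (x, 0)) (r := (z, 0)) (Set.mem_univ _) (Set.mem_univ _)
    rw [tsum_K1] at h
    simp only [compKer, kdelta]
    rw [show (∑' y : Fin d → ℤ, AX n a x y * limInv Set.univ (Aker n a) (y, 0) (z, 0))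
        = ∑' y : Fin d → ℤ, Aker n a (x, 0) (y, 0) * limInv Set.univ (Aker n a) (y, 0) (z, 0) from rfl, h]
    simp [Prod.ext_iff]
  · funext x z
    have h := tsum_limInv_mul hγ hc one_pos hA (p := (x, 0)) (r := (z, 0)) (Set.mem_univ _) (Set.mem_univ _)
    rw [tsum_K1] at h
    simp only [compKer, kdelta]
    rw [show (∑' y : Fin d → ℤ, limInv Set.univ (Aker n a) (x, 0) (y, 0) * AX n a y z)
        = ∑' y : Fin d → ℤ, limInv Set.univ (Aker n a) (x, 0) (y, 0) * Aker n a (y, 0) (z, 0) from rfl, h]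
    simp [Prod.ext_iff]

/-- **`G′` DECAYS AT A RATE PER BLOCK FREE OF THE MESH**: `Decay₂ G′ (2∕min(2,a)) (δ_u(d,a)∕(d·(n+1)))`, i.e.
`|G′(x,y)| ≤ (2∕min(2,a))·e^{−(δ_u∕d)·|x−y|₁∕(n+1)}` — `|x−y|₁∕(n+1)` being the `ℓ¹` distance in block (= physical) units
(`B6QGQDecay237.gPrime_entry_decay`, sup distance ↦ `ℓ¹`). [cite: Balaban1984PropagatorsI, Prop. 1.2 (1.110) p.35] [folklore] -/
theorem flatGreen_decay (ha : 0 < a) :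
    Decay₂ (fun x y : Fin d → ℤ => limInv Set.univ (Aker n a) (x, 0) (y, 0)) (2 / min 2 a)
      (deltaU d a / ((n : ℝ) + 1) / d) := by
  refine decay₂_of_dist_decay (div_nonneg (deltaU_pos d ha).le (by positivity)) fun x y => ?_
  have h := gPrime_entry_decay (d := d) n ha Set.univ (p := x) (q := y) (Set.mem_univ _) (Set.mem_univ _)
  rw [show deltaU d a / ((n : ℝ) + 1) * dist x y = deltaU d a * (dist x y / ((n : ℝ) + 1)) by ring]
  exact h

/-- The site matrix `Δ^η + aQ*Q` is jointly `(n+1)`-periodic (the blocks are translated into blocks).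
[cite: Balaban1984PropagatorsI, (1.18) p.20] [folklore] -/
theorem AX_isPeriodic₂ (a : ℝ) : IsPeriodic₂ (n + 1) (fun x y : Fin d → ℤ => AX n a x y) := by
  intro x y m
  have hside : side n = ((n + 1 : ℕ) : ℤ) := by unfold side; push_cast; ring
  have hblk : ∀ z : Fin d → ℤ, blk n (imageShift (n + 1) z m) = blk n z + m := by
    intro z; funext μ
    simp only [blk, imageShift_apply, Pi.add_apply, hside]
    rw [Int.add_mul_ediv_left _ _ (by positivity)]
  have hlap : lapKer (imageShift (n + 1) x m) (imageShift (n + 1) y m) = lapKer x y := by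
    unfold lapKer B6QGQLower276.lapDir
    have e1 : ∀ u v : Fin d → ℤ, (imageShift (n + 1) u m = imageShift (n + 1) v m) ↔ u = v :=
      fun u v => ⟨fun h => imageShift_left_injective (n + 1) m h, fun h => by rw [h]⟩
    have e2 : ∀ u v w : Fin d → ℤ, (imageShift (n + 1) u m = imageShift (n + 1) v m + w) ↔ u = v + w := by
      intro u v w
      constructor
      · intro h; funext i
        have hi := congrFun h i
        simp only [imageShift_apply, Pi.add_apply] at hi ⊢; linarith
      · intro h; funext i
        simp only [imageShift_apply, Pi.add_apply, h]; ring
    have e3 : ∀ u v w : Fin d → ℤ, (imageShift (n + 1) u m = imageShift (n + 1) v m - w) ↔ u = v - w := by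
      intro u v w
      constructor
      · intro h; funext i
        have hi := congrFun h i
        simp only [imageShift_apply, Pi.sub_apply] at hi ⊢; linarith
      · intro h; funext i
        simp only [imageShift_apply, Pi.sub_apply, h]; ring
    simp only [e1, e2, e3]
  have hsame : sameBlk n (imageShift (n + 1) x m) (imageShift (n + 1) y m) = sameBlk n x y := by
    unfold sameBlk
    rw [hblk, hblk]
    simp only [add_left_inj]
  simp only [AX, hlap, hsame]

/-- A uniform row bound for the site matrix (finite range, bounded entries; via its `e^{−dist}` entry bound).
[cite: Balaban1984PropagatorsI, (1.18) p.20] [folklore] -/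
theorem AX_rowBound (ha : 0 < a) : RowBound (fun x y : Fin d → ℤ => AX n a x y) (c0 d n a * latticeConst d 1) :=
  rowBound_of_dist_decay (c0_pos d n ha.ne').le one_pos fun x y => by simpa using abs_AX_le (d := d) n a x y

/-- **`G′` IS JOINTLY `(n+1)`-PERIODIC** (uniqueness of two-sided inverses with row bounds, gen 9's
`IsPeriodic₂.of_inverse`) — so its torus periodisations are the torus Green's functions (`EntrywiseVolumeLimit` §3–§4).
[cite: Slade2017, Lemma 2.2.2] [folklore] -/
theorem flatGreen_isPeriodic₂ (ha : 0 < a) :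
    IsPeriodic₂ (n + 1) (fun x y : Fin d → ℤ => limInv Set.univ (Aker n a) (x, 0) (y, 0)) := by
  have hd := flatGreen_decay (d := d) n ha
  have h2 := flatGreen_two_sided (d := d) n ha
  rcases Nat.eq_zero_or_pos d with hd0 | hdpos
  · -- `d = 0`: `ℤ^0` is a point, every kernel is periodic
    subst hd0
    intro x y m
    have hx : imageShift (n + 1) x m = x := funext fun i => Fin.elim0 i
    have hy : imageShift (n + 1) y m = y := funext fun i => Fin.elim0 i
    rw [hx, hy]
  · have hrate : 0 < deltaU d a / ((n : ℝ) + 1) / d := by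
      have := deltaU_pos d ha
      have hd' : (0 : ℝ) < d := by exact_mod_cast hdpos
      positivity
    exact IsPeriodic₂.of_inverse (AX_isPeriodic₂ n a) (AX_rowBound n ha) (hd.rowBound hrate) h2.1 h2.2

/-- `G′` is symmetric. [cite: Balaban1984PropagatorsI, Prop. 1.1 p.33] [folklore] -/
theorem flatGreen_symm (ha : 0 < a) (x y : Fin d → ℤ) :
    limInv Set.univ (Aker n a) (x, 0) (y, 0) = limInv Set.univ (Aker n a) (y, 0) (x, 0) :=
  limInv_symm (lt_min two_pos ha) (c0_pos d n ha.ne') one_pos (hyp56Z_Aker (d := d) n a) _ _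

end Flat

/-! ## §3. `QG′Q*` on the unit lattice as a row letter: mesh-free prefactor and rate, lower bound, translation invariance -/

section QGQ

variable (n : ℕ) {a : ℝ}

/-- **`QG′Q*` DECAYS WITH MESH-FREE PREFACTOR AND RATE**: `Decay₂ (QG′Q*) (c_u(d,a)) (δ_u(d,a)∕d)`
(`B6QGQDecay237.abs_kerQGQ_le_unif`). [cite: Balaban1984PropagatorsII, p.237] [folklore] -/
theorem qgq_decay (ha : 0 < a) : Decay₂ (fun y y' : Fin d → ℤ => kerQGQ n a y y') (cU d a) (deltaU d a / d) :=
  decay₂_of_dist_decay (deltaU_pos d ha).le fun y y' => abs_kerQGQ_le_unif (d := d) n ha y y'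

/-- **`QG′Q* ≥ γ_Q(d,a)` ON FINITELY SUPPORTED VECTORS, MESH-FREE** ([3] (2.76), `B6QGQLower276.qGq_lower`):
`γ_Q Σ_{y∈t} f(y)² ≤ Σ_{y,y′∈t} f(y)(QG′Q*)(y,y′)f(y′)`, `γ_Q = 1∕(36^d(4d+a))`.
[cite: Balaban1984PropagatorsII, (2.76) p.236] [folklore] -/
theorem qgq_lower (ha : 0 < a) (t : Finset (Fin d → ℤ)) (f : (Fin d → ℤ) → ℝ) :
    gammaQ d a * ∑ y ∈ t, f y ^ 2 ≤ ∑ y ∈ t, ∑ y' ∈ t, f y * kerQGQ n a y y' * f y' := by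
  have h := qGq_lower (d := d) n ha t f
  unfold gammaQ
  refine h.trans (le_of_eq (Finset.sum_congr rfl fun y _ => ?_))
  rw [Finset.mul_sum]
  exact Finset.sum_congr rfl fun y' _ => by ring

/-- The blocks translate: `B(y + m) = B(y) + (n+1)·m`. [cite: Balaban1984PropagatorsI, (1.18) p.20] [folklore] -/
theorem B_imageShift (y m : Fin d → ℤ) :
    B n (imageShift 1 y m) = (B n y).image (fun x => imageShift (n + 1) x m) := by
  unfold B
  rw [Finset.image_image]
  refine Finset.image_congr fun z _ => ?_
  funext μ
  simp only [Function.comp_apply, chart, imageShift_apply, side]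
  push_cast
  ring

/-- **`QG′Q*` IS TRANSLATION INVARIANT** (`IsPeriodic₂ 1`), from the joint `(n+1)`-periodicity of `G′` by re-indexing
the blocks. [cite: Balaban1984PropagatorsI, (1.101) p.34] [folklore] -/
theorem qgq_transInv (ha : 0 < a) : IsPeriodic₂ 1 (fun y y' : Fin d → ℤ => kerQGQ n a y y') := by
  intro y y' m
  have hG := flatGreen_isPeriodic₂ (d := d) n ha
  have hinj : ∀ z : Fin d → ℤ, Set.InjOn (fun x : Fin d → ℤ => imageShift (n + 1) x m) ↑(B n z) :=
    fun z => (imageShift_left_injective (n + 1) m).injOn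
  simp only [kerQGQ]
  rw [B_imageShift, B_imageShift, Finset.sum_image (hinj y)]
  congr 1
  refine Finset.sum_congr rfl fun x _ => ?_
  rw [Finset.sum_image (hinj y')]
  exact Finset.sum_congr rfl fun x' _ => hG x x' m

end QGQ

/-! ## §4. `(QG′Q*)⁻¹` on the unit lattice as a row letter -/

section QGQInv

variable (n : ℕ) {a : ℝ}

/-- **`(QG′Q*)⁻¹` IS A TWO-SIDED INVERSE OF `QG′Q*` ON `ℤ^d`**: `compKer (QG′Q*) (QG′Q*)⁻¹ = δ = compKer (QG′Q*)⁻¹ (QG′Q*)`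
(`B4Sect5Exhaustion` with the mesh-free (5.6) `B6QGQDecay237.hyp56Z_KerQGQ_unif`).
[cite: Balaban1985BackgroundPropagators, (3.132) p.422] [folklore] -/
theorem qgqInv_two_sided (ha : 0 < a) :
    compKer (fun y y' : Fin d → ℤ => kerQGQ n a y y') (fun y y' => limInv Set.univ (KerQGQ n a) (y, 0) (y', 0)) = kdelta ∧
    compKer (fun y y' : Fin d → ℤ => limInv Set.univ (KerQGQ n a) (y, 0) (y', 0)) (fun y y' => kerQGQ n a y y')
      = kdelta := by
  have hγ := gammaQ_pos d ha
  have hc := cU_pos d ha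
  have hδ := deltaU_pos d ha
  have hA := hyp56Z_KerQGQ_unif (d := d) n ha
  constructor
  · funext x z
    have h := tsum_mul_limInv hγ hc hδ hA (p := (x, 0)) (r := (z, 0)) (Set.mem_univ _) (Set.mem_univ _)
    rw [tsum_K1] at h
    simp only [compKer, kdelta]
    rw [show (∑' y : Fin d → ℤ, kerQGQ n a x y * limInv Set.univ (KerQGQ n a) (y, 0) (z, 0))
        = ∑' y : Fin d → ℤ, KerQGQ n a (x, 0) (y, 0) * limInv Set.univ (KerQGQ n a) (y, 0) (z, 0) from rfl, h]
    simp [Prod.ext_iff]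
  · funext x z
    have h := tsum_limInv_mul hγ hc hδ hA (p := (x, 0)) (r := (z, 0)) (Set.mem_univ _) (Set.mem_univ _)
    rw [tsum_K1] at h
    simp only [compKer, kdelta]
    rw [show (∑' y : Fin d → ℤ, limInv Set.univ (KerQGQ n a) (x, 0) (y, 0) * kerQGQ n a y z)
        = ∑' y : Fin d → ℤ, limInv Set.univ (KerQGQ n a) (x, 0) (y, 0) * KerQGQ n a (y, 0) (z, 0) from rfl, h]
    simp [Prod.ext_iff]

/-- **`(QG′Q*)⁻¹` DECAYS WITH MESH-FREE PREFACTOR AND RATE**: `Decay₂ (QG′Q*)⁻¹ (cInv d a) (deltaInv d a ∕ d)`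
(`B6QGQDecay237.qGqInv_decay_unif` at `Λ = ℤ^d`) — the flat unit-lattice case of [B9] (3.132) with constants depending
on `d, a` only. [cite: Balaban1985BackgroundPropagators, (3.132) p.422] [folklore] -/
theorem qgqInv_decay (ha : 0 < a) :
    Decay₂ (fun y y' : Fin d → ℤ => limInv Set.univ (KerQGQ n a) (y, 0) (y', 0)) (cInv d a) (deltaInv d a / d) :=
  decay₂_of_dist_decay (deltaInv_pos d ha).le fun y y' => qGqInv_decay_unif (d := d) n ha Set.univ y y'

/-- **`(QG′Q*)⁻¹` IS TRANSLATION INVARIANT** (`IsPeriodic₂ 1`; uniqueness of two-sided inverses with row bounds).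
[cite: Slade2017, Lemma 2.2.2] [folklore] -/
theorem qgqInv_transInv (ha : 0 < a) :
    IsPeriodic₂ 1 (fun y y' : Fin d → ℤ => limInv Set.univ (KerQGQ n a) (y, 0) (y', 0)) := by
  have h2 := qgqInv_two_sided (d := d) n ha
  rcases Nat.eq_zero_or_pos d with hd0 | hdpos
  · subst hd0
    intro x y m
    have hx : imageShift 1 x m = x := funext fun i => Fin.elim0 i
    have hy : imageShift 1 y m = y := funext fun i => Fin.elim0 i
    rw [hx, hy]
  · have hd' : (0 : ℝ) < d := by exact_mod_cast hdpos
    have hr1 : 0 < deltaU d a / d := div_pos (deltaU_pos d ha) hd'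
    have hr2 : 0 < deltaInv d a / d := div_pos (deltaInv_pos d ha) hd'
    exact IsPeriodic₂.of_inverse (qgq_transInv n ha) ((qgq_decay n ha).rowBound hr1)
      ((qgqInv_decay n ha).rowBound hr2) h2.1 h2.2

end QGQInv

/-! ## §5. The three flat one-step letters, packaged -/

/-- **THE k-UNIFORM FLAT ONE-STEP LETTERS OF ROW (D4), BY NAME.**  For every dimension `d`, every mesh `η = 1∕(n+1)` and every
`a > 0` there are `ℤ^d` kernels `G` (fine lattice), `K`, `KI` (unit lattice) — namely `G′ = (Δ^η + aQ*Q)⁻¹`, `QG′Q*`,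
`(QG′Q*)⁻¹` — with: `AX ∘ G = δ = G ∘ AX`, `Decay₂ G (2∕min(2,a)) (δ_u∕(d(n+1)))`, `IsPeriodic₂ (n+1) G`;
`K(y,y′) = (n+1)^{−d}Σ_{B(y)×B(y′)}G`, `Decay₂ K c_u (δ_u∕d)`, `γ_Q Σf² ≤ ΣΣ fKf`, `IsPeriodic₂ 1 K`; `K ∘ KI = δ = KI ∘ K`,
`Decay₂ KI c_inv (δ_inv∕d)`, `IsPeriodic₂ 1 KI` — EVERY CONSTANT A FUNCTION OF `d` AND `a` ONLY (`B6QGQDecay237`'s `deltaU`,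
`cU`, `cInv`, `deltaInv`, `B6QGQLower276.gammaQ`). [cite: Balaban1984PropagatorsI, Prop. 1.2 p.35, (1.99)-(1.103) p.34] [folklore] -/
theorem flatLetters_uniform (n : ℕ) {a : ℝ} (ha : 0 < a) :
    ∃ G K KI : Kernel₂ d,
      (compKer (fun x y : Fin d → ℤ => AX n a x y) G = kdelta ∧ compKer G (fun x y => AX n a x y) = kdelta ∧
        Decay₂ G (2 / min 2 a) (deltaU d a / ((n : ℝ) + 1) / d) ∧ IsPeriodic₂ (n + 1) G) ∧
      ((∀ y y', K y y' = (((n : ℝ) + 1) ^ d)⁻¹ * ∑ p ∈ B n y, ∑ q ∈ B n y', G p q) ∧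
        Decay₂ K (cU d a) (deltaU d a / d) ∧
        (∀ (t : Finset (Fin d → ℤ)) (f : (Fin d → ℤ) → ℝ),
          gammaQ d a * ∑ y ∈ t, f y ^ 2 ≤ ∑ y ∈ t, ∑ y' ∈ t, f y * K y y' * f y') ∧
        IsPeriodic₂ 1 K) ∧
      (compKer K KI = kdelta ∧ compKer KI K = kdelta ∧ Decay₂ KI (cInv d a) (deltaInv d a / d) ∧ IsPeriodic₂ 1 KI) := by
  obtain ⟨h1, h2⟩ := flatGreen_two_sided (d := d) n ha
  obtain ⟨h3, h4⟩ := qgqInv_two_sided (d := d) n ha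
  exact ⟨fun x y => limInv Set.univ (Aker n a) (x, 0) (y, 0), fun y y' => kerQGQ n a y y',
    fun y y' => limInv Set.univ (KerQGQ n a) (y, 0) (y', 0),
    ⟨h1, h2, flatGreen_decay n ha, flatGreen_isPeriodic₂ n ha⟩,
    ⟨fun y y' => rfl, qgq_decay n ha, qgq_lower n ha, qgq_transInv n ha⟩,
    ⟨h3, h4, qgqInv_decay n ha, qgqInv_transInv n ha⟩⟩

end Literature.MathematicalPhysics.QuantumFieldTheory.Balaban1983to89.Beta.RemainderKernelFlatBridge
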